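import Literature.RingTheory.HilbertSamuel.NormalFlatnessCriterion
import Literature.AlgebraicGeometry.Resolution.HilbertSamuelPermissibleConverseDim
import HarnessLib

/-!
# Helper H-B of the crux chain on `SigmaMaxModifications` (route HilbertSamuelElimination):
# Bennett's numerical criterion for a regular centre of any dimension, under the planned names

[OURS · L1 W4.2 — naming layer only] The crux plan for `stub_tameNu3` / the threefold lines of
`SigmaMaxModificationsCorridor3` (item stmt-ResolutionOfSingularities-19249, parent crux
stmt-ResolutionOfSingularities-18506) types a helper **H-B**: Bennett / Herrmann–Ikeda–Orbanz
Thm. (22.24) "if" (CJS Thm. 3.3 (3) ⇒ (1)) for a regular centre of ANY dimension — the tree had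
`r = 1` only, while every threefold line must blow up regular SURFACES inside a Hilbert–Samuel
stratum and then invoke the proved CJS Thm. 3.10 (1). The mathematics is the printed theorem and
lives in `Literature/` (`NormalFlatnessCriterion.lean`: ring level, new elementary proof;
`HilbertSamuelPermissibleConverseDim.lean`: scheme level). This file only provides the three
statements under the names and signatures fixed in the chain's typed helper programme
(`stub_HB_isNormallyFlat_of_hilbertFun_eq_hilbertSamuelFun`, `stub_HB_isNormallyFlat_of_hsFun_eq`,
`stub_HB_isPermissibleAt_of_hsFun_eq`), so that the line skeletons can refer to them verbatim.
Nothing here is a statement of Hironaka's manuscript.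

## Sources

* M. Herrmann, S. Ikeda, U. Orbanz, *Equimultiplicity and Blowing up* (1988), Thm. (22.24).
  [HerrmannIkedaOrbanz1988]
* V. Cossart, U. Jannsen, S. Saito, LNM 2270 (2020), Def. 3.1, Thm. 3.3. [CossartJannsenSaito2020]
-/

set_option linter.dupNamespace false -- mandated namespace of this single-conjunct summit

noncomputable section

open IsLocalRing AlgebraicGeometry CategoryTheory
open Literature.RingTheory.HilbertSamuel Literature.AlgebraicGeometry.Resolution

namespace Summit.ResolutionOfSingularities.ResolutionOfSingularities.Theorems.SigmaMaxModificationsCorridor3.Helpers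

universe u v

/-- **H-B (ring level): Bennett / HIO Thm. (22.24) "if", general `r`.** For a Noetherian local
ring `R`, a prime `𝔭` with `R/𝔭` regular of dimension `r`, and a localization `R_𝔭`:
`H^{(0)}[R] = H^{(r)}[R_𝔭] ⇒ R` normally flat along `𝔭`. (Alias of
`Literature.RingTheory.HilbertSamuel.isNormallyFlat_of_hilbertFun_eq_hilbertSamuelFun` under the
name of the chain's helper programme.) [cite: HerrmannIkedaOrbanz1988, Thm. (22.24)] -/
theorem stub_HB_isNormallyFlat_of_hilbertFun_eq_hilbertSamuelFun {R : Type u} [CommRing R]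
    [IsLocalRing R] [IsNoetherianRing R] (p : Ideal R) [p.IsPrime] (Rp : Type v) [CommRing Rp]
    [Algebra R Rp] [IsLocalization.AtPrime Rp p] [IsLocalRing Rp] [IsRegularLocalRing (R ⧸ p)]
    (r : ℕ) (hdim : ringKrullDim (R ⧸ p) = r) (hH : hilbertFun R = hilbertSamuelFun Rp r) :
    p.IsNormallyFlat :=
  isNormallyFlat_of_hilbertFun_eq_hilbertSamuelFun p Rp r hdim hH

/-- **H-B (scheme level): CJS Thm. 3.3 (3) ⇒ (1) for a regular centre of any dimension.** For
`y ⤳ x` with `𝒪_{X,x}` catenary, `𝒪_{X,x}/𝔭_y` regular of dimension `c`, `N ≥ ψ_X(x)`: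
`H_X(x) = H_X(y) ⇒ X` normally flat along `cl{y}` at `x`. (Alias of
`Literature.AlgebraicGeometry.Resolution.Scheme.isNormallyFlat_of_hsFun_eq_of_ringKrullDim_eq`.)
[cite: CossartJannsenSaito2020, Thm. 3.3] -/
theorem stub_HB_isNormallyFlat_of_hsFun_eq {X : Scheme.{u}} [IsLocallyNoetherian X] (N : ℕ)
    {x y : X} (h : y ⤳ x) (hcat : IsCatenaryRing (X.presheaf.stalk x))
    [IsRegularLocalRing (X.presheaf.stalk x ⧸ primeOfSpecializes h)] {c : ℕ}
    (hc : ringKrullDim (X.presheaf.stalk x ⧸ primeOfSpecializes h) = c)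
    (hN : Scheme.hsPsi X x ≤ N) (hH : Scheme.hsFun X N x = Scheme.hsFun X N y) :
    (primeOfSpecializes h).IsNormallyFlat :=
  Scheme.isNormallyFlat_of_hsFun_eq_of_ringKrullDim_eq N h hcat hc hN hH

/-- **H-B corollary: a regular centre `cl{y}` of any dimension on which `H_X` is constant is
permissible at `x`** (CJS Def. 3.1 (2) with Thm. 3.3), provided `𝔭_y` is not a minimal prime of
`𝒪_{X,x}`. (Alias of `Literature.AlgebraicGeometry.Resolution.IdealSheafData.isPermissibleAt_vanishingIdeal_closure_of_hsFun_eq_of_ringKrullDim_eq`.)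
[cite: CossartJannsenSaito2020, Def. 3.1 (2), Thm. 3.3] -/
theorem stub_HB_isPermissibleAt_of_hsFun_eq {X : Scheme.{u}} [IsLocallyNoetherian X] (N : ℕ)
    {x y : X} (h : y ⤳ x) (hcat : IsCatenaryRing (X.presheaf.stalk x))
    [IsRegularLocalRing (X.presheaf.stalk x ⧸ primeOfSpecializes h)] {c : ℕ}
    (hc : ringKrullDim (X.presheaf.stalk x ⧸ primeOfSpecializes h) = c)
    (hN : Scheme.hsPsi X x ≤ N) (hH : Scheme.hsFun X N x = Scheme.hsFun X N y)
    (hgen : primeOfSpecializes h ∉ minimalPrimes (X.presheaf.stalk x)) :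
    IdealSheafData.IsPermissibleAt
        (AlgebraicGeometry.Scheme.IdealSheafData.vanishingIdeal
          ⟨closure ({y} : Set X), isClosed_closure⟩) x :=
  IdealSheafData.isPermissibleAt_vanishingIdeal_closure_of_hsFun_eq_of_ringKrullDim_eq N h hcat hc
    hN hH hgen

end Summit.ResolutionOfSingularities.ResolutionOfSingularities.Theorems.SigmaMaxModificationsCorridor3.Helpers

end
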